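import Summits.CriticalPhenomena.Ising3DConformalLimit.Theorems.HyperoctahedralRPExistsScaleCovariantLimitBlockDefs
import Literature.Probability.LatticeModels.PointwiseScalingLimitEtaExists
import Literature.Probability.LatticeModels.HighDimPointwiseTriviality
import HarnessLib

/-!
# Two-point scaling from the lattice facts (line `monotone-blocking-port` of crux `ExistsScaleCovariantLimit`,
stmt-CriticalPhenomena-1981; stub `stub_twoPointScaling_of_lattice`, S4c)

Pure real analysis: the block-covariance algebra (S4a), the Messager–Miracle-Solé sandwich together with the
top-heavy-scales lemma (S4b) and the convergence of the block two-point ratios (`BlockTwoLimits`) force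
`TwoPointScaling`: `φ(m) = m⁶ g(m)/V(m) → Φ > 0` and `g(jm)/g(m) → j⁻⁶ c_j > 0`, where `g(m) = ⟨σ₀σ_{me₀}⟩_{β_c}`,
`V(L) = C(L;0)` and `c_j = lim_L V(jL)/V(L)`.

Route. `ρ(L;k) = C(L;k)/V(L) → ρ_∞(k)` (`BlockTwoLimits` at `![0,k]`), so `V(jL)/V(L) = Σ_{a,b ∈ cube j} ρ(L;b−a) →
c_j ≥ 1`, `c` monotone. The sandwich `L⁶ g((q+4)L) ≤ C(L;(q+1)e₀) ≤ L⁶ g(qL)` gives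
`φ((q+4)L) ≤ (q+4)⁶ ρ(L;(q+1)e₀) V(L)/V((q+4)L) → A_q` and `φ(qL) ≥ q⁶ ρ(L;(q+1)e₀) V(L)/V(qL) → B_q`; the
interpolation `φ(m) ≤ ((L+1)/L)⁶ φ(pL)`, `φ(m) ≥ (L/(L+1))⁶ φ(p(L+1))` (`pL ≤ m < p(L+1)`, `g` antitone, `V` monotone)
transfers these eventual bounds from multiples to the whole sequence; `A_q ≤ ((q+4)/q)⁶ B_q`, `B_1 = ρ_∞(2e₀)/c_1 > 0`
(top-heavy lemma at `p = 5`), whence `φ → Φ = sup_q B_q`; finally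
`g(jm)/g(m) = (φ(jm)/φ(m)) · (V(jm)/V(m)) · j⁻⁶ → c_j j⁻⁶`.
-/

noncomputable section

namespace Summit.CriticalPhenomena.Ising3DConformalLimit.Cruxes.ExistsScaleCovariantLimit.MonotoneBlockingPort

open Literature.Probability.LatticeModels Filter Set Finset
open scoped Topology BigOperators

/-! ## Generic real analysis: transfer of eventual bounds from multiples, squeeze -/

/-- `((L+1)/L)⁶ → 1`. [folklore] -/
private theorem tendsto_succ_div_pow_six :
    Tendsto (fun L : ℕ => (((L : ℝ) + 1) / L) ^ 6) atTop (𝓝 1) := by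
  have h := ((tendsto_one_div_atTop_nhds_zero_nat (𝕜 := ℝ)).const_add (1 : ℝ)).pow 6
  rw [add_zero, one_pow] at h
  refine h.congr' ?_
  filter_upwards [eventually_ge_atTop 1] with L hL
  have hL0 : (L : ℝ) ≠ 0 := Nat.cast_ne_zero.2 (by omega)
  rw [add_div, div_self hL0]

/-- `(L/(L+1))⁶ → 1`. [folklore] -/
private theorem tendsto_div_succ_pow_six :
    Tendsto (fun L : ℕ => ((L : ℝ) / ((L : ℝ) + 1)) ^ 6) atTop (𝓝 1) := by
  have h := tendsto_succ_div_pow_six.inv₀ one_ne_zero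
  rw [inv_one] at h
  refine h.congr' (Eventually.of_forall fun L => ?_)
  rw [← inv_pow, inv_div]

/-- Transfer of eventual UPPER bounds along the multiples `p L` to the whole sequence, given the one-step
interpolation inequality `φ(m) ≤ ((L+1)/L)⁶ φ(pL)` for `pL ≤ m < p(L+1)`. [folklore] -/
private theorem eventually_lt_of_multiples {φ : ℕ → ℝ} {p : ℕ} (hp : 0 < p)
    (hstep : ∀ L m : ℕ, 1 ≤ L → p * L ≤ m → m < p * (L + 1) →
      φ m ≤ (((L : ℝ) + 1) / L) ^ 6 * φ (p * L))
    {a : ℝ} (ha : ∀ a', a < a' → ∀ᶠ L : ℕ in atTop, φ (p * L) < a') :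
    ∀ a', a < a' → ∀ᶠ m : ℕ in atTop, φ m < a' := by
  intro a' ha'
  obtain ⟨a'', h1, h2⟩ := exists_between ha'
  have ht : Tendsto (fun L : ℕ => (((L : ℝ) + 1) / L) ^ 6 * a'') atTop (𝓝 a'') := by
    simpa using tendsto_succ_div_pow_six.mul_const a''
  obtain ⟨L₀, hL₀⟩ := eventually_atTop.1
    ((ha a'' h1).and ((ht.eventually (gt_mem_nhds h2)).and (eventually_ge_atTop 1)))
  refine eventually_atTop.2 ⟨p * L₀, fun m hm => ?_⟩
  obtain ⟨hφ, hlt, hL1⟩ :=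
    hL₀ (m / p) ((Nat.le_div_iff_mul_le hp).2 ((Nat.mul_comm _ _).le.trans hm))
  calc φ m ≤ ((((m / p : ℕ) : ℝ) + 1) / (m / p : ℕ)) ^ 6 * φ (p * (m / p)) :=
        hstep (m / p) m hL1 (Nat.mul_div_le m p) (Nat.lt_mul_div_succ m hp)
    _ ≤ ((((m / p : ℕ) : ℝ) + 1) / (m / p : ℕ)) ^ 6 * a'' :=
        mul_le_mul_of_nonneg_left hφ.le (by positivity)
    _ < a' := hlt

/-- Transfer of eventual LOWER bounds along the multiples `p L` to the whole sequence, given the one-step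
interpolation inequality `(L/(L+1))⁶ φ(p(L+1)) ≤ φ(m)` for `pL ≤ m < p(L+1)`. [folklore] -/
private theorem eventually_gt_of_multiples {φ : ℕ → ℝ} {p : ℕ} (hp : 0 < p)
    (hstep : ∀ L m : ℕ, 1 ≤ L → p * L ≤ m → m < p * (L + 1) →
      ((L : ℝ) / ((L : ℝ) + 1)) ^ 6 * φ (p * (L + 1)) ≤ φ m)
    {b : ℝ} (hb : ∀ b', b' < b → ∀ᶠ L : ℕ in atTop, b' < φ (p * L)) :
    ∀ b', b' < b → ∀ᶠ m : ℕ in atTop, b' < φ m := by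
  intro b' hb'
  obtain ⟨b'', h1, h2⟩ := exists_between hb'
  have ht : Tendsto (fun L : ℕ => ((L : ℝ) / ((L : ℝ) + 1)) ^ 6 * b'') atTop (𝓝 b'') := by
    simpa using tendsto_div_succ_pow_six.mul_const b''
  have hb1 : ∀ᶠ L : ℕ in atTop, b'' < φ (p * (L + 1)) :=
    (tendsto_add_atTop_nat 1).eventually (hb b'' h2)
  obtain ⟨L₀, hL₀⟩ := eventually_atTop.1
    (hb1.and ((ht.eventually (lt_mem_nhds h1)).and (eventually_ge_atTop 1)))
  refine eventually_atTop.2 ⟨p * L₀, fun m hm => ?_⟩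
  obtain ⟨hφ, hlt, hL1⟩ :=
    hL₀ (m / p) ((Nat.le_div_iff_mul_le hp).2 ((Nat.mul_comm _ _).le.trans hm))
  calc b' < (((m / p : ℕ) : ℝ) / (((m / p : ℕ) : ℝ) + 1)) ^ 6 * b'' := hlt
    _ ≤ (((m / p : ℕ) : ℝ) / (((m / p : ℕ) : ℝ) + 1)) ^ 6 * φ (p * (m / p + 1)) :=
        mul_le_mul_of_nonneg_left hφ.le (by positivity)
    _ ≤ φ m := hstep (m / p) m hL1 (Nat.mul_div_le m p) (Nat.lt_mul_div_succ m hp)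

/-- The squeeze: eventual upper bounds `A_q`, eventual lower bounds `B_q` (`q ≥ 1`), `B_1 > 0` and
`A_q ≤ K_q B_q` with `K_q → 1` force convergence to `Φ = sup_q B_q > 0`. [folklore] -/
private theorem tendsto_of_squeeze {φ A B K : ℕ → ℝ}
    (hU : ∀ q, 1 ≤ q → ∀ a', A q < a' → ∀ᶠ m in atTop, φ m < a')
    (hLo : ∀ q, 1 ≤ q → ∀ b', b' < B q → ∀ᶠ m in atTop, b' < φ m)
    (hB1 : 0 < B 1) (hAB : ∀ q, 1 ≤ q → A q ≤ K q * B q) (hK : Tendsto K atTop (𝓝 1)) :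
    ∃ Φ : ℝ, 0 < Φ ∧ Tendsto φ atTop (𝓝 Φ) := by
  have hBA : ∀ q q', 1 ≤ q → 1 ≤ q' → B q ≤ A q' := by
    intro q q' hq hq'
    by_contra h
    push Not at h
    obtain ⟨x, h1, h2⟩ := exists_between h
    obtain ⟨m, hm1, hm2⟩ := ((hU q' hq' x h1).and (hLo q hq x h2)).exists
    exact lt_irrefl _ (hm1.trans hm2)
  have hbdd : BddAbove (Set.range fun i : ℕ => B (i + 1)) :=
    ⟨A 1, by rintro _ ⟨i, rfl⟩; exact hBA (i + 1) 1 (by omega) le_rfl⟩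
  have hBΦ : ∀ i : ℕ, B (i + 1) ≤ ⨆ i : ℕ, B (i + 1) := fun i => le_ciSup hbdd i
  have hΦpos : 0 < ⨆ i : ℕ, B (i + 1) := hB1.trans_le (hBΦ 0)
  refine ⟨⨆ i : ℕ, B (i + 1), hΦpos, tendsto_order.2 ⟨fun a ha => ?_, fun b hb => ?_⟩⟩
  · obtain ⟨i, hi⟩ := exists_lt_of_lt_ciSup ha
    exact hLo (i + 1) (by omega) a hi
  · have hK1 : Tendsto (fun i : ℕ => K (i + 1)) atTop (𝓝 1) := hK.comp (tendsto_add_atTop_nat 1)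
    have hK' : Tendsto (fun i : ℕ => K (i + 1) * ⨆ i : ℕ, B (i + 1)) atTop (𝓝 (⨆ i : ℕ, B (i + 1))) := by
      simpa using hK1.mul_const (⨆ i : ℕ, B (i + 1))
    obtain ⟨i, hi1, hi2⟩ :=
      ((hK'.eventually (gt_mem_nhds hb)).and (hK1.eventually (lt_mem_nhds zero_lt_one))).exists
    refine hU (i + 1) (by omega) b ?_
    calc A (i + 1) ≤ K (i + 1) * B (i + 1) := hAB (i + 1) (by omega)
      _ ≤ K (i + 1) * ⨆ i : ℕ, B (i + 1) := mul_le_mul_of_nonneg_left (hBΦ i) hi2.le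
      _ < b := hi1

/-! ## The scaling sequence `φ(m) = m⁶ g(m)/V(m)`: interpolation and the bounds along multiples -/

/-- Upper interpolation `φ(m) ≤ ((L+1)/L)⁶ φ(pL)` for `pL ≤ m < p(L+1)` (`g` antitone, `V` monotone). [folklore] -/
private theorem step_upper {g V : ℕ → ℝ} (hga : Antitone g) (hgp : ∀ m, 0 < g m)
    (hVpos : ∀ L, 1 ≤ L → 0 < V L) (hVmono : Monotone V) {p : ℕ} (hp : 1 ≤ p)
    (L m : ℕ) (hL : 1 ≤ L) (h1 : p * L ≤ m) (h2 : m < p * (L + 1)) :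
    (m : ℝ) ^ 6 * g m / V m ≤
      (((L : ℝ) + 1) / L) ^ 6 * (((p * L : ℕ) : ℝ) ^ 6 * g (p * L) / V (p * L)) := by
  have hL0 : (L : ℝ) ≠ 0 := Nat.cast_ne_zero.2 (by omega)
  have hpL : 1 ≤ p * L := le_trans hp (Nat.le_mul_of_pos_right p hL)
  have hVpL : 0 < V (p * L) := hVpos _ hpL
  have hV0 : V (p * L) ≠ 0 := hVpL.ne'
  have hm : (m : ℝ) ^ 6 ≤ ((p : ℝ) * ((L : ℝ) + 1)) ^ 6 := by
    have : (m : ℝ) ≤ (p : ℝ) * ((L : ℝ) + 1) := by exact_mod_cast h2.le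
    gcongr
  have key : (m : ℝ) ^ 6 * g m / V m ≤ ((p : ℝ) * ((L : ℝ) + 1)) ^ 6 * g (p * L) / V (p * L) :=
    div_le_div₀ (mul_nonneg (by positivity) (hgp _).le)
      (mul_le_mul hm (hga h1) (hgp m).le (by positivity)) hVpL (hVmono h1)
  calc (m : ℝ) ^ 6 * g m / V m ≤ ((p : ℝ) * ((L : ℝ) + 1)) ^ 6 * g (p * L) / V (p * L) := key
    _ = (((L : ℝ) + 1) / L) ^ 6 * (((p * L : ℕ) : ℝ) ^ 6 * g (p * L) / V (p * L)) := by
      push_cast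
      field_simp

/-- Lower interpolation `(L/(L+1))⁶ φ(p(L+1)) ≤ φ(m)` for `pL ≤ m < p(L+1)` (`g` antitone, `V` monotone). [folklore] -/
private theorem step_lower {g V : ℕ → ℝ} (hga : Antitone g) (hgp : ∀ m, 0 < g m)
    (hVpos : ∀ L, 1 ≤ L → 0 < V L) (hVmono : Monotone V) {p : ℕ} (hp : 1 ≤ p)
    (L m : ℕ) (hL : 1 ≤ L) (h1 : p * L ≤ m) (h2 : m < p * (L + 1)) :
    ((L : ℝ) / ((L : ℝ) + 1)) ^ 6 * (((p * (L + 1) : ℕ) : ℝ) ^ 6 * g (p * (L + 1)) / V (p * (L + 1))) ≤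
      (m : ℝ) ^ 6 * g m / V m := by
  have hL1 : (L : ℝ) + 1 ≠ 0 := by positivity
  have hpL : 1 ≤ p * L := le_trans hp (Nat.le_mul_of_pos_right p hL)
  have hVm : 0 < V m := hVpos m (hpL.trans h1)
  have hV0 : V (p * (L + 1)) ≠ 0 := (hVpos _ (hpL.trans (Nat.mul_le_mul_left p (Nat.le_succ L)))).ne'
  have hm : ((p : ℝ) * L) ^ 6 ≤ (m : ℝ) ^ 6 := by
    have : (p : ℝ) * L ≤ (m : ℝ) := by exact_mod_cast h1
    gcongr
  have key : ((p : ℝ) * L) ^ 6 * g (p * (L + 1)) / V (p * (L + 1)) ≤ (m : ℝ) ^ 6 * g m / V m :=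
    div_le_div₀ (mul_nonneg (by positivity) (hgp _).le)
      (mul_le_mul hm (hga h2.le) (hgp _).le (by positivity)) hVm (hVmono h2.le)
  calc _ = ((p : ℝ) * L) ^ 6 * g (p * (L + 1)) / V (p * (L + 1)) := by
        push_cast
        field_simp
    _ ≤ _ := key

/-- `c_j = lim_L V(jL)/V(L) ≥ 1` for `j ≥ 1` (`V` monotone and positive). [folklore] -/
private theorem one_le_covRatioLimit {V : ℕ → ℝ} {c : ℕ → ℝ}
    (hVpos : ∀ L, 1 ≤ L → 0 < V L) (hVmono : Monotone V)
    (hc : ∀ j, Tendsto (fun L => V (j * L) / V L) atTop (𝓝 (c j))) {j : ℕ} (hj : 1 ≤ j) : 1 ≤ c j := by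
  refine ge_of_tendsto (hc j) ?_
  filter_upwards [eventually_ge_atTop 1] with L hL
  rw [one_le_div₀ (hVpos L hL)]
  exact hVmono (Nat.le_mul_of_pos_left L hj)

/-- The sandwich turned into eventual bounds along multiples: for `q ≥ 1`,
`φ((q+4)L) ≤ (q+4)⁶ ρ(L;(q+1)e₀) V(L)/V((q+4)L) → A_q` and `φ(qL) ≥ q⁶ ρ(L;(q+1)e₀) V(L)/V(qL) → B_q`. [folklore] -/
private theorem bounds_at_multiples {g V : ℕ → ℝ} {C : ℕ → ℕ → ℝ} {c ρ : ℕ → ℝ}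
    (hVpos : ∀ L, 1 ≤ L → 0 < V L) (hVmono : Monotone V)
    (hc : ∀ j, Tendsto (fun L => V (j * L) / V L) atTop (𝓝 (c j)))
    (hρ : ∀ j, Tendsto (fun L => C L j / V L) atTop (𝓝 (ρ j)))
    (hsand : ∀ j L : ℕ, 1 ≤ j →
      (L : ℝ) ^ 6 * g ((j + 3) * L) ≤ C L j ∧ C L j ≤ (L : ℝ) ^ 6 * g ((j - 1) * L))
    {q : ℕ} (hq : 1 ≤ q) :
    (∀ a', ((q : ℝ) + 4) ^ 6 * ρ (q + 1) / c (q + 4) < a' →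
        ∀ᶠ L : ℕ in atTop, (((q + 4) * L : ℕ) : ℝ) ^ 6 * g ((q + 4) * L) / V ((q + 4) * L) < a') ∧
    (∀ b', b' < (q : ℝ) ^ 6 * ρ (q + 1) / c q →
        ∀ᶠ L : ℕ in atTop, b' < ((q * L : ℕ) : ℝ) ^ 6 * g (q * L) / V (q * L)) := by
  have hsq : ∀ L : ℕ,
      (L : ℝ) ^ 6 * g ((q + 4) * L) ≤ C L (q + 1) ∧ C L (q + 1) ≤ (L : ℝ) ^ 6 * g (q * L) := by
    intro L
    have h := hsand (q + 1) L (by omega)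
    rwa [show q + 1 + 3 = q + 4 by omega, Nat.add_sub_cancel] at h
  constructor
  · have hX : Tendsto (fun L : ℕ => ((q : ℝ) + 4) ^ 6 * (C L (q + 1) / V L) / (V ((q + 4) * L) / V L))
        atTop (𝓝 (((q : ℝ) + 4) ^ 6 * ρ (q + 1) / c (q + 4))) :=
      ((hρ (q + 1)).const_mul _).div (hc (q + 4))
        (by linarith [one_le_covRatioLimit hVpos hVmono hc (show 1 ≤ q + 4 by omega)])
    intro a' ha'
    filter_upwards [hX.eventually (gt_mem_nhds ha'), eventually_ge_atTop 1] with L hL hL1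
    refine lt_of_le_of_lt ?_ hL
    have hV0 : V L ≠ 0 := (hVpos L hL1).ne'
    have hV4 : 0 < V ((q + 4) * L) := hVpos _ (le_trans hL1 (Nat.le_mul_of_pos_left L (by omega)))
    rw [← mul_div_assoc, div_div_div_cancel_right₀ hV0]
    refine div_le_div_of_nonneg_right ?_ hV4.le
    calc (((q + 4) * L : ℕ) : ℝ) ^ 6 * g ((q + 4) * L)
        = ((q : ℝ) + 4) ^ 6 * ((L : ℝ) ^ 6 * g ((q + 4) * L)) := by push_cast; ring
      _ ≤ ((q : ℝ) + 4) ^ 6 * C L (q + 1) := mul_le_mul_of_nonneg_left (hsq L).1 (by positivity)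
  · have hY : Tendsto (fun L : ℕ => (q : ℝ) ^ 6 * (C L (q + 1) / V L) / (V (q * L) / V L))
        atTop (𝓝 ((q : ℝ) ^ 6 * ρ (q + 1) / c q)) :=
      ((hρ (q + 1)).const_mul _).div (hc q) (by linarith [one_le_covRatioLimit hVpos hVmono hc hq])
    intro b' hb'
    filter_upwards [hY.eventually (lt_mem_nhds hb'), eventually_ge_atTop 1] with L hL hL1
    refine lt_of_lt_of_le hL ?_
    have hV0 : V L ≠ 0 := (hVpos L hL1).ne'
    have hVq : 0 < V (q * L) := hVpos _ (le_trans hL1 (Nat.le_mul_of_pos_left L hq))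
    rw [← mul_div_assoc, div_div_div_cancel_right₀ hV0]
    refine div_le_div_of_nonneg_right ?_ hVq.le
    calc (q : ℝ) ^ 6 * C L (q + 1) ≤ (q : ℝ) ^ 6 * ((L : ℝ) ^ 6 * g (q * L)) :=
          mul_le_mul_of_nonneg_left (hsq L).2 (by positivity)
      _ = ((q * L : ℕ) : ℝ) ^ 6 * g (q * L) := by push_cast; ring

/-- Part (i) in the abstract setting: `φ(m) = m⁶ g(m)/V(m) → Φ > 0`. [folklore] -/
private theorem exists_scaling_limit {g V : ℕ → ℝ} {C : ℕ → ℕ → ℝ} {c ρ : ℕ → ℝ}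
    (hga : Antitone g) (hgp : ∀ m, 0 < g m)
    (hVpos : ∀ L, 1 ≤ L → 0 < V L) (hVmono : Monotone V)
    (hc : ∀ j, Tendsto (fun L => V (j * L) / V L) atTop (𝓝 (c j)))
    (hρ : ∀ j, Tendsto (fun L => C L j / V L) atTop (𝓝 (ρ j)))
    (hsand : ∀ j L : ℕ, 1 ≤ j →
      (L : ℝ) ^ 6 * g ((j + 3) * L) ≤ C L j ∧ C L j ≤ (L : ℝ) ^ 6 * g ((j - 1) * L))
    (htop : ∀ p : ℕ, 1 ≤ p → ∃ ε : ℝ, 0 < ε ∧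
      ∃ᶠ L : ℕ in atTop, ε * V L ≤ (L : ℝ) ^ 6 * g (p * L)) :
    ∃ Φ : ℝ, 0 < Φ ∧ Tendsto (fun m : ℕ => (m : ℝ) ^ 6 * g m / V m) atTop (𝓝 Φ) := by
  have hc1 : ∀ j, 1 ≤ j → 1 ≤ c j := fun j hj => one_le_covRatioLimit hVpos hVmono hc hj
  have hcmono : ∀ j j', j ≤ j' → c j ≤ c j' := fun j j' hjj' =>
    le_of_tendsto_of_tendsto (hc j) (hc j') (by
      filter_upwards [eventually_ge_atTop 1] with L hL
      exact div_le_div_of_nonneg_right (hVmono (Nat.mul_le_mul_right L hjj')) (hVpos L hL).le)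
  have hρnn : ∀ j, 1 ≤ j → 0 ≤ ρ j := fun j hj =>
    ge_of_tendsto (hρ j) (by
      filter_upwards [eventually_ge_atTop 1] with L hL
      exact div_nonneg ((mul_nonneg (by positivity) (hgp _).le).trans (hsand j L hj).1) (hVpos L hL).le)
  refine tendsto_of_squeeze (φ := fun m : ℕ => (m : ℝ) ^ 6 * g m / V m)
    (A := fun q => ((q : ℝ) + 4) ^ 6 * ρ (q + 1) / c (q + 4))
    (B := fun q => (q : ℝ) ^ 6 * ρ (q + 1) / c q)
    (K := fun q => (((q : ℝ) + 4) / q) ^ 6) ?_ ?_ ?_ ?_ ?_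
  · intro q hq
    exact eventually_lt_of_multiples (p := q + 4) (by omega)
      (fun L m hL h1 h2 => step_upper hga hgp hVpos hVmono (by omega) L m hL h1 h2)
      (bounds_at_multiples hVpos hVmono hc hρ hsand hq).1
  · intro q hq
    exact eventually_gt_of_multiples (p := q) hq
      (fun L m hL h1 h2 => step_lower hga hgp hVpos hVmono hq L m hL h1 h2)
      (bounds_at_multiples hVpos hVmono hc hρ hsand hq).2
  · -- `B_1 = ρ_∞(2e₀)/c_1 > 0` by the top-heavy lemma at `p = 5` and the sandwich at `j = 2`
    obtain ⟨ε, hε, hfr⟩ := htop 5 (by norm_num)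
    have hρ2 : ε ≤ ρ 2 := by
      refine ge_of_tendsto_of_frequently (hρ 2) ?_
      refine (hfr.and_eventually (eventually_ge_atTop 1)).mono fun L hL => ?_
      rw [le_div_iff₀ (hVpos L hL.2)]
      exact hL.1.trans (hsand 2 L (by norm_num)).1
    have e : ((1 : ℕ) : ℝ) ^ 6 * ρ (1 + 1) / c 1 = ρ 2 / c 1 := by norm_num
    show 0 < ((1 : ℕ) : ℝ) ^ 6 * ρ (1 + 1) / c 1
    rw [e]
    exact div_pos (hε.trans_le hρ2) (by linarith [hc1 1 le_rfl])
  · intro q hq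
    show ((q : ℝ) + 4) ^ 6 * ρ (q + 1) / c (q + 4) ≤ (((q : ℝ) + 4) / q) ^ 6 * ((q : ℝ) ^ 6 * ρ (q + 1) / c q)
    have hq0 : (q : ℝ) ≠ 0 := Nat.cast_ne_zero.2 (by omega)
    have hcq : 0 < c q := by linarith [hc1 q hq]
    calc ((q : ℝ) + 4) ^ 6 * ρ (q + 1) / c (q + 4) ≤ ((q : ℝ) + 4) ^ 6 * ρ (q + 1) / c q :=
          div_le_div_of_nonneg_left (mul_nonneg (by positivity) (hρnn (q + 1) (by omega))) hcq
            (hcmono q (q + 4) (by omega))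
      _ = (((q : ℝ) + 4) / q) ^ 6 * ((q : ℝ) ^ 6 * ρ (q + 1) / c q) := by
          field_simp
  · have h := ((tendsto_const_div_atTop_nhds_zero_nat (4 : ℝ)).const_add 1).pow 6
    rw [add_zero, one_pow] at h
    refine h.congr' ?_
    filter_upwards [eventually_ge_atTop 1] with q hq
    have hq0 : (q : ℝ) ≠ 0 := Nat.cast_ne_zero.2 (by omega)
    show ((1 : ℝ) + 4 / q) ^ 6 = (((q : ℝ) + 4) / q) ^ 6
    rw [add_div, div_self hq0]

/-- Parts (i) and (ii) in the abstract setting. [folklore] -/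
private theorem twoPointScaling_abstract {g V : ℕ → ℝ} {C : ℕ → ℕ → ℝ} {c ρ : ℕ → ℝ}
    (hga : Antitone g) (hgp : ∀ m, 0 < g m)
    (hVpos : ∀ L, 1 ≤ L → 0 < V L) (hVmono : Monotone V)
    (hc : ∀ j, Tendsto (fun L => V (j * L) / V L) atTop (𝓝 (c j)))
    (hρ : ∀ j, Tendsto (fun L => C L j / V L) atTop (𝓝 (ρ j)))
    (hsand : ∀ j L : ℕ, 1 ≤ j →
      (L : ℝ) ^ 6 * g ((j + 3) * L) ≤ C L j ∧ C L j ≤ (L : ℝ) ^ 6 * g ((j - 1) * L))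
    (htop : ∀ p : ℕ, 1 ≤ p → ∃ ε : ℝ, 0 < ε ∧
      ∃ᶠ L : ℕ in atTop, ε * V L ≤ (L : ℝ) ^ 6 * g (p * L)) :
    (∃ Φ : ℝ, 0 < Φ ∧ Tendsto (fun m : ℕ => (m : ℝ) ^ 6 * g m / V m) atTop (𝓝 Φ)) ∧
    (∀ j : ℕ, 1 ≤ j → ∃ r : ℝ, 0 < r ∧ Tendsto (fun m : ℕ => g (j * m) / g m) atTop (𝓝 r)) := by
  obtain ⟨Φ, hΦ, hφ⟩ := exists_scaling_limit hga hgp hVpos hVmono hc hρ hsand htop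
  refine ⟨⟨Φ, hΦ, hφ⟩, fun j hj => ?_⟩
  have hc1 : 1 ≤ c j := one_le_covRatioLimit hVpos hVmono hc hj
  have hjm : Tendsto (fun m : ℕ => j * m) atTop atTop :=
    tendsto_atTop_mono (fun m => Nat.le_mul_of_pos_left m hj) tendsto_id
  have hlim := (((hφ.comp hjm).div hφ hΦ.ne').mul (hc j)).div_const ((j : ℝ) ^ 6)
  rw [div_self hΦ.ne', one_mul] at hlim
  refine ⟨c j / (j : ℝ) ^ 6, div_pos (by linarith) (by positivity), hlim.congr' ?_⟩
  filter_upwards [eventually_ge_atTop 1] with m hm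
  have hm0 : (m : ℝ) ≠ 0 := Nat.cast_ne_zero.2 (by omega)
  have hj0 : (j : ℝ) ≠ 0 := Nat.cast_ne_zero.2 (by omega)
  have hg0 : g m ≠ 0 := (hgp m).ne'
  have hgj0 : g (j * m) ≠ 0 := (hgp _).ne'
  have hV0 : V m ≠ 0 := (hVpos m hm).ne'
  have hVj0 : V (j * m) ≠ 0 := (hVpos _ (le_trans hm (Nat.le_mul_of_pos_left m hj))).ne'
  simp only [Pi.div_apply, Function.comp_apply]
  push_cast
  field_simp

/-! ## Lattice bookkeeping: the ratio limits from `BlockTwoLimits` -/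

/-- `ρ(L;k) = C(L;k)/V(L)` converges for every `k` (`BlockTwoLimits` at `![0,k]` for `k ≠ 0`; `≡ 1` eventually
for `k = 0`). [folklore] -/
private theorem ratio_limits (hVpos : ∀ L : ℕ, 1 ≤ L → 0 < blockCov L 0)
    (hR2 : ∀ (L : ℕ) (k : Fin 2 → Site 3), critBlockMoment 2 L k = blockCov L (k 1 - k 0) / blockCov L 0)
    (hBTL : BlockTwoLimits) (k : Site 3) :
    ∃ r : ℝ, Tendsto (fun L : ℕ => blockCov L k / blockCov L 0) atTop (𝓝 r) := by
  by_cases hk : k = 0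
  · subst hk
    refine ⟨1, tendsto_const_nhds.congr' ?_⟩
    filter_upwards [eventually_ge_atTop 1] with L hL
    exact (div_self (hVpos L hL).ne').symm
  · have hinj : Function.Injective (![0, k] : Fin 2 → Site 3) := by
      intro i i' h
      fin_cases i <;> fin_cases i' <;> simp at h ⊢
      · exact hk h.symm
      · exact hk h
    obtain ⟨r, hr⟩ := hBTL ![0, k] hinj
    refine ⟨r, ?_⟩
    simpa [hR2] using hr

/-- `V(jL)/V(L) → c_j = Σ_{a,b ∈ cube j} ρ_∞(b − a)` (sub-cube decomposition). [folklore] -/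
private theorem cov_limits {ρ : Site 3 → ℝ}
    (hρ : ∀ k, Tendsto (fun L : ℕ => blockCov L k / blockCov L 0) atTop (𝓝 (ρ k)))
    (hVdec : ∀ j L : ℕ, blockCov (j * L) 0 = ∑ a ∈ cube j, ∑ b ∈ cube j, blockCov L (b - a)) (j : ℕ) :
    Tendsto (fun L : ℕ => blockCov (j * L) 0 / blockCov L 0) atTop
      (𝓝 (∑ a ∈ cube j, ∑ b ∈ cube j, ρ (b - a))) := by
  have h : (fun L : ℕ => blockCov (j * L) 0 / blockCov L 0) =
      fun L => ∑ a ∈ cube j, ∑ b ∈ cube j, blockCov L (b - a) / blockCov L 0 := by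
    funext L
    rw [hVdec j L, Finset.sum_div]
    exact Finset.sum_congr rfl fun a _ => Finset.sum_div _ _ _
  rw [h]
  exact tendsto_finsetSum _ fun a _ => tendsto_finsetSum _ fun b _ => hρ (b - a)

/-! ## The stub -/

/-- **S4c — two-point scaling from the lattice facts and the block two-point limits.**
`Sig.stub_blockCovAlgebra → Sig.stub_blockCovTwoPointBounds → BlockTwoLimits → TwoPointScaling`: with
`φ(m) = m⁶ g(m)/V(m)`, the block two-point limits give `V(jL)/V(L) → c_j ≥ 1` and `C(L;je₀)/V(L) → ρ_∞(je₀)`; the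
sandwich bounds `φ` along multiples (`B_q ≤ liminf`, `limsup ≤ A_q ≤ ((q+4)/q)⁶ B_q`), monotonicity of `g`, `V`
interpolates to the full sequence, the top-heavy lemma gives `B_1 > 0`, so `φ → Φ = sup B_q > 0`, and
`g(jm)/g(m) = (φ(jm)/φ(m)) (V(jm)/V(m)) j⁻⁶ → c_j j⁻⁶ > 0` (regular-variation bookkeeping in the sense of
Bingham–Goldie–Teugels, *Regular Variation* §1.9; the lattice inputs are the hypotheses). [folklore] -/
theorem stub_twoPointScaling_of_lattice : Sig.stub_twoPointScaling_of_lattice := by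
  rintro ⟨hVpos, hVmono, hVdec, hR2⟩ ⟨hsand, htop⟩ hBTL
  choose ρ hρ using ratio_limits hVpos hR2 hBTL
  unfold TwoPointScaling
  exact twoPointScaling_abstract (g := fun m : ℕ => criticalTwoPoint 3 (Pi.single 0 (m : ℤ)))
    (V := fun L : ℕ => blockCov L 0) (C := fun L j => blockCov L (Pi.single 0 (j : ℤ)))
    (c := fun j => ∑ a ∈ cube j, ∑ b ∈ cube j, ρ (b - a)) (ρ := fun j => ρ (Pi.single 0 (j : ℤ)))
    criticalTwoPoint_axis_antitone criticalTwoPoint_axis_pos hVpos hVmono (cov_limits hρ hVdec)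
    (fun j => hρ _) hsand htop

end Summit.CriticalPhenomena.Ising3DConformalLimit.Cruxes.ExistsScaleCovariantLimit.MonotoneBlockingPort

end
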